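import Mathlib
import HarnessLib
import Summits.ValiantsHypothesis.ValiantsHypothesis.Theses.PermanentalCones
import Literature.Computability.AlgebraicComplexity.ValiantClasses
import Literature.Computability.AlgebraicComplexity.ArithCircuit
import Literature.Computability.AlgebraicComplexity.ArithCircuitProofs
import Literature.Computability.AlgebraicComplexity.IMMInVPProofs
import Literature.Computability.AlgebraicComplexity.DetInVP
import Literature.Computability.AlgebraicComplexity.DeterminantalComplexityProofs
import Literature.Computability.AlgebraicComplexity.DeterminantalConormalBoundKernelAlgebra

/-!
# ValiantsHypothesis / PermanentalCones — `HyperbolicVPShadow`, sub-goal V: determinants of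
# p-bounded affine pencils form a `VP_ℂ` family

Route `PermanentalCones`, item `stmt-ValiantsHypothesis-8655` (crux `HyperbolicVPShadow`), line
`birth`, stub `permanentalCones_isVPFamily_det_affine`.

Let `M_k` be an `N_k × N_k` matrix of real affine-linear forms (entries of total degree `≤ 1`) in
`v_k` variables, with `N` and `v` p-bounded. Then `k ↦ det M_k` (complexified) is a `VP_ℂ` family:

* p-family: `v_k` variables, and `deg det M_k ≤ N_k` (`totalDegree_le_of_hasDetRepr_holds`; the
  change of scalars `ℝ → ℂ` does not raise the total degree);
* p-computable: `det M_k = DET_{N_k}(entries of M_k)` is a substitution instance of the generic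
  determinant, so `L(det M_k) ≤ L(DET_{N_k}) + Σ_{i,j} L((M_k)ᵢⱼ) ≤ 8 (N_k + 1)⁷ + N_k² (2 v_k + 1)`
  by Berkowitz (`complexity_detPoly_le`), the substitution bound `complexity_aeval_le`
  (Bürgisser 2000, Rem. 2.7) and the affine expansion `p = p₀ + Σᵢ pᵢ Xᵢ` of each entry
  (one product and one sum gate per variable).

The arithmetic of p-bounded functions (`IsPBounded.add_holds` etc.) closes the bound.
-/

-- `<Problem> = <Summit>` for this single-conjunct summit (lakefile sets the same option tree-wide).
set_option linter.dupNamespace false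

namespace Summit.ValiantsHypothesis.ValiantsHypothesis.Theorems

open MvPolynomial Literature.Computability.AlgebraicComplexity

/-- A change of scalars does not increase the total degree: `deg (map f p) ≤ deg p`. [folklore] -/
theorem permanentalCones_totalDegree_map_le {R S σ : Type*} [CommSemiring R] [CommSemiring S]
    (f : R →+* S) (p : MvPolynomial σ R) :
    (MvPolynomial.map f p).totalDegree ≤ p.totalDegree :=
  Finset.sup_mono (MvPolynomial.support_map_subset f p)

/-- An affine-linear polynomial in `n` variables costs at most `2 n + 1` gates:
`p = C p₀ + Σᵢ C pᵢ * Xᵢ`, one product per variable, `n` additions for the sum (counted by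
`complexity_finset_sum_le`) and one final addition (Bürgisser 2000, §2.1). [folklore] -/
theorem permanentalCones_complexity_affine_le {R : Type*} [CommSemiring R] {n : ℕ}
    (p : MvPolynomial (Fin n) R) (hp : p.totalDegree ≤ 1) :
    complexity p ≤ 2 * n + 1 := by
  have hterm : ∀ i : Fin n,
      complexity (C (coeff (Finsupp.single i 1) p) * X i : MvPolynomial (Fin n) R) ≤ 1 := by
    intro i
    calc complexity (C (coeff (Finsupp.single i 1) p) * X i : MvPolynomial (Fin n) R)
        ≤ complexity (C (coeff (Finsupp.single i 1) p) : MvPolynomial (Fin n) R) +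
            complexity (X i : MvPolynomial (Fin n) R) + 1 := complexity_mul_le_holds _ _
      _ = 1 := by rw [complexity_C_holds, complexity_X_holds]
  have hsum : complexity (∑ i : Fin n, C (coeff (Finsupp.single i 1) p) * X i :
      MvPolynomial (Fin n) R) ≤ n + n := by
    refine (complexity_finset_sum_le _ _).trans ?_
    rw [Finset.card_univ, Fintype.card_fin]
    refine Nat.add_le_add_right ?_ _
    calc ∑ i : Fin n, complexity (C (coeff (Finsupp.single i 1) p) * X i : MvPolynomial (Fin n) R)
        ≤ ∑ _i : Fin n, 1 := Finset.sum_le_sum fun i _ => hterm i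
      _ = n := by simp
  calc complexity p
      = complexity (C (coeff 0 p) + ∑ i : Fin n, C (coeff (Finsupp.single i 1) p) * X i) :=
        congrArg complexity (DeterminantalConormal.eq_C_add_sum_of_totalDegree_le_one hp)
    _ ≤ complexity (C (coeff 0 p) : MvPolynomial (Fin n) R) +
          complexity (∑ i : Fin n, C (coeff (Finsupp.single i 1) p) * X i :
            MvPolynomial (Fin n) R) + 1 := complexity_add_le_holds _ _
    _ ≤ 0 + (n + n) + 1 := by
        rw [complexity_C_holds]
        exact Nat.add_le_add_right (Nat.add_le_add_left hsum _) _
    _ = 2 * n + 1 := by ring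

/-- The determinant of a square matrix of polynomials is the substitution instance of the generic
determinant `DET_N` at its entries. [folklore] -/
theorem permanentalCones_det_eq_aeval_detPoly {S : Type*} [CommRing S] {σ : Type*} {N : ℕ}
    (B : Matrix (Fin N) (Fin N) (MvPolynomial σ S)) :
    B.det = aeval (fun q : Fin N × Fin N => B q.1 q.2) (detPoly (Fin N) S) := by
  rw [detPoly, AlgHom.map_det, Matrix.mvPolynomialX_mapMatrix_aeval S B]

/-- `L(det B) ≤ L(DET_N) + Σ_{i,j} L(Bᵢⱼ) ≤ 8 (N + 1)⁷ + N² b` when every entry costs at most `b`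
(Berkowitz's bound `complexity_detPoly_le` and the substitution bound `complexity_aeval_le`,
Bürgisser 2000, Rem. 2.7 and Prop. 2.30). [cite: Burgisser2000, Prop. 2.30] -/
theorem permanentalCones_complexity_det_le {S : Type*} [CommRing S] {σ : Type*} {N b : ℕ}
    (B : Matrix (Fin N) (Fin N) (MvPolynomial σ S)) (hB : ∀ i j, complexity (B i j) ≤ b) :
    complexity B.det ≤ 8 * (N + 1) ^ 7 + N * N * b := by
  rw [permanentalCones_det_eq_aeval_detPoly B]
  refine (complexity_aeval_le _ _).trans (Nat.add_le_add (complexity_detPoly_le S N) ?_)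
  calc ∑ q : Fin N × Fin N, complexity (B q.1 q.2) ≤ ∑ _q : Fin N × Fin N, b :=
        Finset.sum_le_sum fun q _ => hB q.1 q.2
    _ = N * N * b := by simp

/-- The determinant of an `N × N` matrix of affine-linear forms in `n` variables, after any change
of scalars, costs at most `8 (N + 1)⁷ + N² (2 n + 1)` gates. [cite: Burgisser2000, Prop. 2.30] -/
theorem permanentalCones_complexity_map_det_le {R S : Type*} [CommRing R] [CommRing S]
    (f : R →+* S) {n N : ℕ} (A : Matrix (Fin N) (Fin N) (MvPolynomial (Fin n) R))
    (hA : ∀ i j, (A i j).totalDegree ≤ 1) :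
    complexity (MvPolynomial.map f A.det) ≤ 8 * (N + 1) ^ 7 + N * N * (2 * n + 1) := by
  rw [RingHom.map_det]
  refine permanentalCones_complexity_det_le _ fun i j => ?_
  rw [RingHom.mapMatrix_apply, Matrix.map_apply]
  exact permanentalCones_complexity_affine_le _
    ((permanentalCones_totalDegree_map_le f _).trans (hA i j))

/-- The cost bound `8 (N_k + 1)⁷ + N_k² (2 v_k + 1)` is p-bounded when `N` and `v` are
(closure of p-bounded functions under sums, products and powers, Bürgisser 2000, Def. 2.1).
[folklore] -/
theorem permanentalCones_isPBounded_detCost {v N : ℕ → ℕ} (hv : IsPBounded v)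
    (hN : IsPBounded N) :
    IsPBounded fun k => 8 * (N k + 1) ^ 7 + N k * N k * (2 * v k + 1) :=
  IsPBounded.add_holds
    (IsPBounded.mul_holds (IsPBounded.const 8)
      (IsPBounded.pow_holds (IsPBounded.add_holds hN (IsPBounded.const 1)) 7))
    (IsPBounded.mul_holds (IsPBounded.mul_holds hN hN)
      (IsPBounded.add_holds (IsPBounded.mul_holds (IsPBounded.const 2) hv) (IsPBounded.const 1)))

/-- **Sub-goal V of `HyperbolicVPShadow → HyperbolicDetShadow`**: determinants of real affine
pencils `M_k` (entries of total degree `≤ 1`) of p-bounded size `N_k` in p-bounded many variables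
`v_k` form, after complexification, a `VP_ℂ` family — a p-family (`v_k` variables, degree
`≤ N_k`) of p-bounded complexity `≤ 8 (N_k + 1)⁷ + N_k² (2 v_k + 1)` (Berkowitz; Bürgisser 2000,
Prop. 2.30 and Rem. 2.7). [cite: Burgisser2000, Prop. 2.30] -/
theorem permanentalCones_isVPFamily_det_affine :
    ∀ (v N : ℕ → ℕ) (M : ∀ k : ℕ, Matrix (Fin (N k)) (Fin (N k)) (MvPolynomial (Fin (v k)) ℝ)),
      Literature.Computability.AlgebraicComplexity.IsPBounded v →
      Literature.Computability.AlgebraicComplexity.IsPBounded N →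
      (∀ k i j, (M k i j).totalDegree ≤ 1) →
      Literature.Computability.AlgebraicComplexity.IsVPFamily
        (fun k => MvPolynomial.map (algebraMap ℝ ℂ) (M k).det) := by
  intro v N M hv hN hdeg
  refine ⟨⟨hv.mono fun k => (Fintype.card_fin _).le, hN.mono fun k => ?_⟩, ?_⟩
  · exact (permanentalCones_totalDegree_map_le _ _).trans
      (totalDegree_le_of_hasDetRepr_holds ⟨M k, hdeg k, rfl⟩)
  · exact (permanentalCones_isPBounded_detCost hv hN).mono fun k =>
      permanentalCones_complexity_map_det_le (algebraMap ℝ ℂ) (M k) (hdeg k)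

end Summit.ValiantsHypothesis.ValiantsHypothesis.Theorems
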